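import Literature.AlgebraicGeometry.GroupSchemes.BarsottiTateGroupFixedPartBaseChange
import Literature.AlgebraicGeometry.GroupSchemes.BTGroupRingActionCompletion
import HarnessLib

/-!
# The `𝒪`-action on the fixed part of an idempotent is compatible with base change

Topic `Literature/AlgebraicGeometry/GroupSchemes`; namespaces `Literature.AlgebraicGeometry.GroupSchemes.BTGroup.Hom` (§1) and
`….GroupSchemes.IsRingActionBT` (§2).  THEOREMS ONLY (no definition, no named fact, no instance, no notation, no `sorry`).  Cell `hodgecm-mathlib`
(D-0151), FLOOR 0, P6 «MOD programme» (crux hLiu418 = stmt-HodgeConjecture-24832), completion of organ (O-BTε)∕(O-BTcong) for the ED. 3 interface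
`ModuliDatum` D2 (F0P6a-plan ED3-CENSUS v1 §1: «`𝒢 :=` the `w`-block `fixBTGroup` DERIVED, WITH its `𝒪_{F,w}`-action; fibres at the three levels by base
change»): the comparison isomorphism ★ `fixBTGroupBaseChangeIso : (Fix ε) ×_S S′ ≅ Fix (ε ×_S S′)` INTERTWINES the restricted actions (★ `fixRestrict`)
and the retractions, and a ring action `β` (★ `IsRingActionBT`) base-changes to a ring action with `completedAction` commuting with base change — so
the `𝒪_{F,w}`-module structure of the `w`-block read on `Spec κ̄`, `Spec 𝒪_Ω`, `Spec Ω` is ONE structure pulled back.  HC_CM is proved only modulo the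
printed citations until rung 0 closes; nothing here is about HC.

THE PRINT.  [Messing1972] Ch. I (1.1)–(1.6) (Barsotti–Tate groups and their homomorphisms are stable under base change); [Tate1967] §2 (2.1);
[RapoportSmithlingZhang2020Diagonal] §4.1 (p. 17) «(dec pdiv)» (the `w`-decomposition with its `O_{F,w}`-actions, functorial).

* §1 `baseChange_fixRestrict_comp_iso` (**`(res φ) ×_S S′ ≫ ≅ = ≅ ≫ res (φ ×_S S′)`**), `baseChange_fixBTGroupRetract_comp_iso` (`r ×_S S′ ≫ ≅ = r′`),
  `iso_inv_comp_baseChange_fixBTGroupι` (`≅⁻¹ ≫ ι ×_S S′ = ι′`).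
* §2 (`B` over `Spec A`, `g : Spec A′ → Spec A`) **`isRingActionBT_baseChange`** (`a ↦ (β a) ×_S S′` is a ring action), `baseChange_homOfCompatibleFamily`,
  **`baseChange_completedAction`** (the completed action commutes with base change, definitionally layerwise).

## References
* [Messing1972] W. Messing, *The Crystals Associated to Barsotti–Tate Groups*, LNM 264 (1972) — Ch. I (1.1)–(1.6).
* [Tate1967] J. T. Tate, *p-divisible groups* (Driebergen 1966), Springer 1967 — §2 (2.1).
* [RapoportSmithlingZhang2020Diagonal] M. Rapoport, B. Smithling, W. Zhang, Compos. Math. 156 (2020) — §4.1 (p. 17).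
-/

noncomputable section

-- `(B.baseChange g).G n = (Over.pullback g).obj (B.G n)` and the transported group laws are definitional only above `instances` transparency.
set_option backward.isDefEq.respectTransparency false

universe u v

open CategoryTheory CategoryTheory.Limits AlgebraicGeometry MonoidalCategory CartesianMonoidalCategory
open scoped MonObj CategoryTheory.Obj

namespace Literature.AlgebraicGeometry.GroupSchemes

/-! ## §1 The comparison isomorphism intertwines restrictions and retractions -/

namespace BTGroup.Hom

variable {S S' : Scheme.{u}} {p h h' : ℕ} {B : BTGroup S p h} {B' : BTGroup S p h'} (g : S' ⟶ S)
  (ε : Hom B B) (hε : ∀ n, ε.app n ≫ ε.app n = ε.app n) (h₁ : ℕ)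
  (hrank : ∀ n (s : S), (ε.fixLayer n).hom.finrank s = p ^ (n * h₁))
  (ε' : Hom B' B') (hε' : ∀ n, ε'.app n ≫ ε'.app n = ε'.app n) (h₁' : ℕ)
  (hrank' : ∀ n (s : S), (ε'.fixLayer n).hom.finrank s = p ^ (n * h₁'))

/-- `≅⁻¹ ≫ (ι ×_S S′) … `: the inverse comparison followed by the base-changed inclusion is the inclusion of `Fix (ε ×_S S′)`.
[cite: Messing1972, Ch. I (1.1)–(1.6)] -/
theorem iso_inv_comp_baseChange_fixBTGroupι :
    (fixBTGroupBaseChangeIso g ε hε h₁ hrank).inv.comp ((ε.fixBTGroupι hε h₁ hrank).baseChange g) =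
      (ε.baseChange g).fixBTGroupι (baseChange_idem g ε hε) h₁ (hrank_baseChange g ε hε h₁ hrank) := by
  rw [← fixBTGroupBaseChangeIso_hom_comp_fixBTGroupι g ε hε h₁ hrank, ← comp_assoc,
    (fixBTGroupBaseChangeIso g ε hε h₁ hrank).inv_hom_id, id_comp]

/-- **THE RESTRICTED HOMOMORPHISMS ARE COMPATIBLE WITH BASE CHANGE**: for `φ : B → B′` commuting with the idempotents,
`((res φ) ×_S S′) ≫ ≅_{ε′} = ≅_{ε} ≫ res (φ ×_S S′)` — both composites are `(ι ≫ φ) ×_S S′` after `ι′`.  In particular the `𝒪`-action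
`a ↦ res (β a)` on `Fix ε` base-changes to the `𝒪`-action on `Fix (ε ×_S S′)`. [cite: Messing1972, Ch. I (1.1)–(1.6)]
[cite: RapoportSmithlingZhang2020Diagonal, §4.1 (p. 17)] -/
theorem baseChange_fixRestrict_comp_iso (φ : Hom B B') (hφ : ∀ n, φ.app n ≫ ε'.app n = ε.app n ≫ φ.app n) :
    ((fixRestrict ε hε h₁ hrank ε' hε' h₁' hrank' φ hφ).baseChange g).comp (fixBTGroupBaseChangeIso g ε' hε' h₁' hrank').hom =
      (fixBTGroupBaseChangeIso g ε hε h₁ hrank).hom.comp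
        (fixRestrict (ε.baseChange g) (baseChange_idem g ε hε) h₁ (hrank_baseChange g ε hε h₁ hrank)
          (ε'.baseChange g) (baseChange_idem g ε' hε') h₁' (hrank_baseChange g ε' hε' h₁' hrank')
          (φ.baseChange g) (baseChange_comm g ε ε' φ hφ)) := by
  apply comp_fixBTGroupι_injective (ε'.baseChange g) (baseChange_idem g ε' hε') h₁' (hrank_baseChange g ε' hε' h₁' hrank')
  rw [comp_assoc, fixBTGroupBaseChangeIso_hom_comp_fixBTGroupι, ← baseChange_comp, fixRestrict_comp_fixBTGroupι, baseChange_comp,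
    comp_assoc, fixRestrict_comp_fixBTGroupι, ← comp_assoc, fixBTGroupBaseChangeIso_hom_comp_fixBTGroupι]

/-- **The retractions are compatible with base change**: `(r ×_S S′) ≫ ≅ = r′` (both are `ε ×_S S′` after `ι′`).
[cite: Messing1972, Ch. I (1.1)–(1.6)] -/
theorem baseChange_fixBTGroupRetract_comp_iso :
    ((ε.fixBTGroupRetract hε h₁ hrank).baseChange g).comp (fixBTGroupBaseChangeIso g ε hε h₁ hrank).hom =
      (ε.baseChange g).fixBTGroupRetract (baseChange_idem g ε hε) h₁ (hrank_baseChange g ε hε h₁ hrank) := by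
  apply comp_fixBTGroupι_injective (ε.baseChange g) (baseChange_idem g ε hε) h₁ (hrank_baseChange g ε hε h₁ hrank)
  rw [comp_assoc, fixBTGroupBaseChangeIso_hom_comp_fixBTGroupι, ← baseChange_comp, fixBTGroupRetract_comp_fixBTGroupι,
    fixBTGroupRetract_comp_fixBTGroupι]

end BTGroup.Hom

/-! ## §2 Ring actions base-change to ring actions; the completed action commutes with base change -/

namespace IsRingActionBT

variable {A A' : Type u} [CommRing A] [CommRing A'] {p H : ℕ} {B : BTGroup (Spec (.of A)) p H} {𝒪 : Type v} [CommRing 𝒪]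
  {β : 𝒪 → BTGroup.Hom B B} (g : Spec (.of A') ⟶ Spec (.of A))

/-- **A ring action base-changes to a ring action**: `a ↦ (β a) ×_A A′` satisfies `IsRingActionBT` on `B ×_A A′` (base change is a monoidal
functor: it preserves `id`, `comp` and layerwise sums). [cite: Messing1972, Ch. I (1.1)–(1.6)] [cite: Tate1967, §2 (2.1)] -/
theorem isRingActionBT_baseChange (hβ : IsRingActionBT B β) : IsRingActionBT (B.baseChange g) (fun a => (β a).baseChange g) := by
  refine ⟨?_, fun a b => ?_, fun a b n => ?_⟩
  · change (β 1).baseChange g = _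
    rw [hβ.map_one, BTGroup.Hom.baseChange_id]
  · change (β (a * b)).baseChange g = _
    rw [hβ.map_mul, BTGroup.Hom.baseChange_comp]
  · letI := B.grpObj n
    change (Over.pullback g).map ((β (a + b)).app n) =
      (Over.pullback g).map ((β a).app n) * (Over.pullback g).map ((β b).app n)
    rw [hβ.app_add', Functor.map_mul]

/-- The family endomorphism base-changes to the family endomorphism of the base-changed action (layerwise definitional).
[cite: Tate1967, §2 (2.1)] -/
theorem baseChange_homOfCompatibleFamily (hβ : IsRingActionBT B β) (a : ℕ → 𝒪)
    (ha : ∀ n, a (n + 1) - a n ∈ Ideal.span {(p : 𝒪) ^ n}) :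
    (hβ.homOfCompatibleFamily a ha).baseChange g = (hβ.isRingActionBT_baseChange g).homOfCompatibleFamily a ha :=
  BTGroup.Hom.ext fun _ => rfl

/-- **The completed action commutes with base change**: `(x̂) ×_A A′ = x̂′` for every `x ∈ 𝒪̂_I` (same Cauchy representative on both sides).
[cite: Tate1967, §2 (2.1)] [cite: RapoportSmithlingZhang2020Diagonal, §4.1 (p. 17)] -/
theorem baseChange_completedAction (hβ : IsRingActionBT B β) {I : Ideal 𝒪} (hI : I ≤ Ideal.span {(p : 𝒪)}) (x : AdicCompletion I 𝒪) :
    (hβ.completedAction hI x).baseChange g = (hβ.isRingActionBT_baseChange g).completedAction hI x :=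
  BTGroup.Hom.ext fun _ => rfl

end IsRingActionBT

end Literature.AlgebraicGeometry.GroupSchemes

end
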